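import Summits.AnomalousDissipation.AnomalousDissipation.Theorems.SolenoidalFractalHomogenisationRealisedQuasiStaticCellLawWeakFarScalars
import HarnessLib

/-!
# K2R `RealisedQuasiStaticCellLaw`, line `floquet-bloch`, stub `stub_lowSectorWeakNear`: per-slot scalar hypotheses of the
# W-near road at the replayed cell word (helper; `--supports stmt-AnomalousDissipation-20446`)

Summits-side helper file (pure real arithmetic; no definitions, no named facts). Four of the seven scalar hypotheses of
`isoSector_decay_of_rates` (p595074) at `W′ = (cubatureWord.stretch M).stretch (1/ν)`, `κ = ν/n²`, `ε = δ/8`, `β = 2·10⁵/δ`,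
in the atoms of the recorded goal shapes (HOME/ad-solenoidal-k2r-lowerlaw-p1/W-NEAR-CELL-GOALSHAPES-g3.md): `F = |m_j|²`,
`bm = ‖m_j‖`, `τ = τ_j`, `θ = ê_j·k`, `a = ‖k‖`, the free rate `lam = λ` with `λP′ ≤ 1/100`, `λ ≤ ν` and
`a²/(10⁴n²ν) ≤ λ`:
* `near_hF`: `2(1−2ε)λτ′_j ≤ 8π²κ(n/2)²τ′_j`;
* `near_hsmall`: `g_j²·(128/7) + 2λ/Λ′_j ≤ 7/16`;
* `near_hβ`: `hβ'` per slot with the global factor `Ξ = e^{4ΣY} ≤ 11/10` abstracted;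
* `near_hJ`: the slaving junk is absorbed, `junk_j/e^{−2λP′} ≤ 2ελτ′_j`, once `δM ≥ 400`, `10⁴‖k‖ ≤ δ·nν`, `λP′ ≤ 1/100`
  and `a²/(10⁴n²ν) ≤ λ` (the three global conditions hSY/hposY/hlamY and the bound Ξ ≤ 11/10 are left to the successor, design note §10).
-/

set_option linter.dupNamespace false

noncomputable section

namespace Summit.AnomalousDissipation.AnomalousDissipation.Theorems.SolenoidalFractalHomogenisation.RealisedQuasiStaticCellLaw

open Real

/-- `hF` at the cell: `2(1−2(δ/8))(λ(Mτ/ν)) ≤ 8π²(ν/n²)(n/2)²(Mτ/ν)` when `λ ≤ ν`. -/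
theorem near_hF {δ lam M τ ν n : ℝ} (hδ : 0 ≤ δ) (hlam0 : 0 ≤ lam) (hlam : lam ≤ ν) (hM : 0 < M) (hτ : 0 < τ)
    (hν : 0 < ν) (hn : 0 < n) :
    2 * (1 - 2 * (δ / 8)) * (lam * (M * τ / ν)) ≤ 8 * π ^ 2 * (ν / n ^ 2) * (n / 2) ^ 2 * (M * τ / ν) := by
  have hπ := Real.pi_gt_three
  have e : 8 * π ^ 2 * (ν / n ^ 2) * (n / 2) ^ 2 * (M * τ / ν) = 2 * π ^ 2 * (M * τ) := by
    field_simp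
    ring
  rw [e]
  have hMτ : 0 < M * τ := mul_pos hM hτ
  have h1 : lam * (M * τ / ν) ≤ M * τ := by
    rw [show lam * (M * τ / ν) = lam / ν * (M * τ) by ring]
    exact mul_le_of_le_one_left hMτ.le ((div_le_one hν).2 hlam)
  have h2 : 0 ≤ lam * (M * τ / ν) := by positivity
  have h3 : (1 - 2 * (δ / 8)) * (lam * (M * τ / ν)) ≤ lam * (M * τ / ν) := by nlinarith only [hδ, h2]
  have hπ2 : (1 : ℝ) ≤ π ^ 2 := by nlinarith only [hπ]
  have h4 : M * τ ≤ π ^ 2 * (M * τ) := le_mul_of_one_le_left hMτ.le hπ2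
  linarith only [h3, h1, h4]

/-- `hsmall` at the cell: `g²·(4·2/(7/16)) + 2λ/(4π²Fν) ≤ 7/16` (`g² ≤ 10⁻¹⁰`, `λ ≤ ν`, `F ≥ 1`). -/
theorem near_hsmall {θ a F bm n ν lam : ℝ} (hθ : |θ| ≤ a) (hF1 : 1 ≤ F) (hbm1 : 1 ≤ bm) (hn : 0 < n) (hν : 0 < ν)
    (han : 10000 * a ≤ n * ν) (hlam0 : 0 ≤ lam) (hlam : lam ≤ ν) :
    (θ / (8 * π ^ 2 * F * bm * n * ν)) ^ 2 * (4 * 2 / (7 / 16)) + 2 * lam / (4 * π ^ 2 * F * ν) ≤ 7 / 16 := by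
  have hπ := Real.pi_gt_three
  have hg := far_coupling_sq_small hθ hF1 hbm1 hn hν han
  have h2 : 2 * lam / (4 * π ^ 2 * F * ν) ≤ 1 / 8 := by
    rw [div_le_iff₀ (by positivity)]
    have h3 : lam ≤ F * ν := le_trans hlam (le_mul_of_one_le_left hν.le hF1)
    have hπ2 : (9 : ℝ) ≤ π ^ 2 := by nlinarith only [hπ]
    have h4 : 9 * (F * ν) ≤ π ^ 2 * (F * ν) := mul_le_mul_of_nonneg_right hπ2 (by positivity)
    linarith only [h3, h4, hlam0]
  nlinarith only [hg, h2, sq_nonneg (θ / (8 * π ^ 2 * F * bm * n * ν))]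

/-- `hJ` at the cell: the slaving junk of slot `j` is below `2ελτ′_j` (`ε = δ/8`, `β = 2·10⁵/δ`, `ρ = 1/2`). -/
theorem near_hJ {θ a F bm τ M ν n lam δ ρ : ℝ} (hθ : |θ| ≤ a) (hF1 : 1 ≤ F) (hbm1 : 1 ≤ bm) (hτ : 40 ≤ τ)
    (hM : 0 < M) (hν : 0 < ν) (hn : 0 < n) (hδ : 0 < δ) (hδ1 : δ ≤ 1) (hMδ : 400 ≤ δ * M)
    (han : 10000 * a ≤ δ * (n * ν)) (hlam0 : 0 ≤ lam) (hx : lam * (M * 3720 / ν) ≤ 1 / 100)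
    (hlamlo : a ^ 2 / (10000 * (n ^ 2 * ν)) ≤ lam) (hρ : ρ = 1 / 2) :
    (40 * (200000 / δ) * 2 * (4 * π ^ 2 * F * ν) * (M * τ / ν) * (θ / (8 * π ^ 2 * F * bm * n * ν)) ^ 4 *
          (1 + (θ / (8 * π ^ 2 * F * bm * n * ν)) ^ 2 * (32 / 7) ^ 2) / (7 / 16) ^ 3 +
        48 * (200000 / δ) * 2 * (θ / (8 * π ^ 2 * F * bm * n * ν)) ^ 2 /
          (ρ * (M * τ / ν) * (4 * π ^ 2 * F * ν) * (7 / 16) ^ 3)) / Real.exp (-(2 * lam * (M * 3720 / ν))) ≤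
      2 * (δ / 8) * (lam * (M * τ / ν)) := by
  subst hρ
  have hπ := Real.pi_gt_three
  have hπ4 := Real.pi_lt_four
  have ha0 : 0 ≤ a := le_trans (abs_nonneg _) hθ
  have hnν : 0 < n * ν := mul_pos hn hν
  have hτ0 : 0 < τ := by linarith
  have hF0 : 0 < F := by linarith
  have hy : 16000 ≤ δ * M * τ := by nlinarith only [hMδ, hτ, mul_pos hδ hM]
  have hy0 : 0 < δ * M * τ := by linarith
  -- the coupling `G = g²` and the sector weight `Q = a²/(n²ν²)`
  obtain ⟨G, hG⟩ : ∃ G : ℝ, (θ / (8 * π ^ 2 * F * bm * n * ν)) ^ 2 = G := ⟨_, rfl⟩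
  have e4 : (θ / (8 * π ^ 2 * F * bm * n * ν)) ^ 4 = G ^ 2 := by rw [← hG]; ring
  rw [e4, hG]
  have hG0 : 0 ≤ G := by rw [← hG]; positivity
  obtain ⟨Q, hQ⟩ : ∃ Q : ℝ, a ^ 2 / (n ^ 2 * ν ^ 2) = Q := ⟨_, rfl⟩
  have hQ0 : 0 ≤ Q := by rw [← hQ]; positivity
  have hD : 72 * F * (n * ν) ≤ 8 * π ^ 2 * F * bm * n * ν := by
    have h1 : (9 : ℝ) ≤ π ^ 2 := by nlinarith only [hπ]
    have h2 : 9 * F ≤ π ^ 2 * F * bm := by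
      have := mul_le_mul h1 hbm1 zero_le_one (by positivity)
      nlinarith only [this, hF0]
    nlinarith only [h2, hnν]
  have hGa : G * (5184 * (F ^ 2 * (n ^ 2 * ν ^ 2))) ≤ a ^ 2 := by
    have hθ2 : θ ^ 2 ≤ a ^ 2 := by
      rw [← sq_abs]; exact pow_le_pow_left₀ (abs_nonneg _) hθ 2
    have hGD : G * (8 * π ^ 2 * F * bm * n * ν) ^ 2 = θ ^ 2 := by
      have hDpos : 0 < 8 * π ^ 2 * F * bm * n * ν := lt_of_lt_of_le (by positivity) hD
      rw [← hG, div_pow]; field_simp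
    have hD2 : (72 * F * (n * ν)) ^ 2 ≤ (8 * π ^ 2 * F * bm * n * ν) ^ 2 :=
      pow_le_pow_left₀ (by positivity) hD 2
    have := mul_le_mul_of_nonneg_left hD2 hG0
    nlinarith only [this, hGD, hθ2]
  have hGQF : G * (5184 * F ^ 2) ≤ Q := by
    rw [← hQ, le_div_iff₀ (by positivity)]
    nlinarith only [hGa]
  have hGQ1 : G * 5184 ≤ Q := by
    have hF2 : 1 ≤ F ^ 2 := one_le_pow₀ hF1
    nlinarith only [hGQF, hF2, hG0]
  have hGδ : G * (5184 * 10 ^ 8) ≤ δ ^ 2 := by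
    have ha2 : (10000 * a) ^ 2 ≤ (δ * (n * ν)) ^ 2 := pow_le_pow_left₀ (by positivity) han 2
    have hF2 : 1 ≤ F ^ 2 := one_le_pow₀ hF1
    have h1 : G * (5184 * (n ^ 2 * ν ^ 2)) ≤ a ^ 2 := by
      have := mul_le_mul_of_nonneg_left hF2 (by positivity : 0 ≤ G * (5184 * (n ^ 2 * ν ^ 2)))
      nlinarith only [this, hGa]
    have h3 : G * (5184 * 10 ^ 8) * (n * ν) ^ 2 ≤ δ ^ 2 * (n * ν) ^ 2 := by nlinarith only [h1, ha2]
    exact le_of_mul_le_mul_right h3 (pow_pos hnν 2)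
  have hδ2 : δ ^ 2 ≤ 1 := by nlinarith only [hδ, hδ1]
  have hGsmall : G * (5184 * 10 ^ 8) ≤ 1 := hGδ.trans hδ2
  have hB : 1 + G * (32 / 7) ^ 2 ≤ 2 := by nlinarith only [hGsmall, hG0]
  -- the free decay factor
  have hE : 98 / 100 ≤ Real.exp (-(2 * lam * (M * 3720 / ν))) := by
    have := Real.add_one_le_exp (-(2 * lam * (M * 3720 / ν)))
    nlinarith only [this, hx, hlam0]
  have hEpos : 0 < Real.exp (-(2 * lam * (M * 3720 / ν))) := Real.exp_pos _
  rw [div_le_iff₀ hEpos]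
  -- term 2
  have e2 : 48 * (200000 / δ) * 2 * G / (1 / 2 * (M * τ / ν) * (4 * π ^ 2 * F * ν) * (7 / 16) ^ 3) =
      19200000 * (4096 / 343) / 2 * G / (π ^ 2 * F * (δ * M * τ)) := by
    field_simp
    ring
  have t2 : 48 * (200000 / δ) * 2 * G / (1 / 2 * (M * τ / ν) * (4 * π ^ 2 * F * ν) * (7 / 16) ^ 3) ≤
      2500 * Q / (δ * M * τ) := by
    rw [e2, div_le_div_iff₀ (by positivity) hy0]
    have h9 : 9 ≤ π ^ 2 := by nlinarith only [hπ]
    have hπF : 9 ≤ π ^ 2 * F := by nlinarith only [h9, hF1]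
    have p1 := mul_le_mul_of_nonneg_right hGQ1 hy0.le
    have p3 := mul_le_mul_of_nonneg_left hπF (by positivity : 0 ≤ 2500 * Q * (δ * M * τ))
    have p0 : 0 ≤ Q * (δ * M * τ) := by positivity
    linarith only [p1, p3, p0]
  -- term 1
  have e1 : 40 * (200000 / δ) * 2 * (4 * π ^ 2 * F * ν) * (M * τ / ν) * G ^ 2 * (1 + G * (32 / 7) ^ 2) / (7 / 16) ^ 3 =
      16000000 * 4 * (4096 / 343) * π ^ 2 * F * G ^ 2 * (1 + G * (32 / 7) ^ 2) * (δ * M * τ) / δ ^ 2 := by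
    field_simp
    ring
  have t1 : 40 * (200000 / δ) * 2 * (4 * π ^ 2 * F * ν) * (M * τ / ν) * G ^ 2 * (1 + G * (32 / 7) ^ 2) / (7 / 16) ^ 3 ≤
      92 / 10 ^ 7 * (δ * M * τ) * Q := by
    rw [e1, div_le_iff₀ (by positivity)]
    have hπ16 : π ^ 2 ≤ 16 := by nlinarith only [hπ4, hπ]
    have hu : 0 ≤ F * G ^ 2 * (δ * M * τ) := by positivity
    -- π²(1 + Gk) ≤ 32
    have q1 : 0 ≤ (16 - π ^ 2) * (1 + G * (32 / 7) ^ 2) := mul_nonneg (by linarith only [hπ16]) (by positivity)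
    have q2 : π ^ 2 * (1 + G * (32 / 7) ^ 2) ≤ 32 := by nlinarith only [q1, hB]
    have m1 := mul_le_mul_of_nonneg_left q2 (mul_nonneg (by norm_num : (0:ℝ) ≤ 16000000 * 4 * (4096 / 343)) hu)
    -- F G² ≤ δ² Q / (5184e8·5184)
    have m2 : G * (5184 * 10 ^ 8) * (G * (5184 * F ^ 2)) ≤ δ ^ 2 * Q :=
      mul_le_mul hGδ hGQF (by positivity) (by positivity)
    have m3 : F * G ^ 2 ≤ F ^ 2 * G ^ 2 := by
      have : 0 ≤ (F ^ 2 - F) * G ^ 2 := mul_nonneg (by nlinarith only [hF1]) (sq_nonneg G)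
      linarith only [this]
    have m4 : F * G ^ 2 * (5184 * 10 ^ 8 * 5184) ≤ δ ^ 2 * Q := by linarith only [m2, m3]
    have m5 := mul_le_mul_of_nonneg_right m4 hy0.le
    nlinarith only [m1, m5, hu, hy0, hQ0, hδ]
  -- the right-hand side
  have r1 : 245 / 10 ^ 7 * (δ * M * τ) * Q ≤
      2 * (δ / 8) * (lam * (M * τ / ν)) * Real.exp (-(2 * lam * (M * 3720 / ν))) := by
    have h1 : a ^ 2 / (10000 * (n ^ 2 * ν)) * (M * τ / ν) ≤ lam * (M * τ / ν) :=
      mul_le_mul_of_nonneg_right hlamlo (by positivity)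
    have e : a ^ 2 / (10000 * (n ^ 2 * ν)) * (M * τ / ν) = (M * τ) * Q / 10000 := by
      rw [← hQ]; field_simp
    rw [e] at h1
    have h2 : 0 ≤ 2 * (δ / 8) * (lam * (M * τ / ν)) := by positivity
    have h3 := mul_le_mul (mul_le_mul_of_nonneg_left h1 (by positivity : (0:ℝ) ≤ 2 * (δ / 8))) hE (by norm_num) h2
    nlinarith only [h3]
  -- conclusion
  have key : 2500 * Q / (δ * M * τ) ≤ 150 / 10 ^ 7 * (δ * M * τ) * Q := by
    rw [div_le_iff₀ hy0]
    have : 2500 ≤ 150 / 10 ^ 7 * (δ * M * τ) ^ 2 := by nlinarith only [hy]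
    nlinarith only [this, hQ0]
  have hyQ : 0 ≤ δ * M * τ * Q := by positivity
  linarith only [t1, t2, r1, key, hyQ]

/-- `hβ'` at the cell, per slot, with the global factor `Ξ = e^{4ΣY} ≤ 11/10` abstracted: `16Ξ²g_j²Λ′_j·2 ≤ e^{−2λP′}ελβΔ`
(`ε = δ/8`, `β = 2·10⁵/δ`, `Δ = 7/16`). -/
theorem near_hβ {θ a F bm M ν n lam δ Ξ : ℝ} (hθ : |θ| ≤ a) (hF1 : 1 ≤ F) (hbm1 : 1 ≤ bm)
    (hν : 0 < ν) (hn : 0 < n) (hδ : 0 < δ) (hlam0 : 0 ≤ lam) (hx : lam * (M * 3720 / ν) ≤ 1 / 100)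
    (hlamlo : a ^ 2 / (10000 * (n ^ 2 * ν)) ≤ lam) (hΞ0 : 0 ≤ Ξ) (hΞ : Ξ ≤ 11 / 10) :
    16 * Ξ ^ 2 * (θ / (8 * π ^ 2 * F * bm * n * ν)) ^ 2 * (4 * π ^ 2 * F * ν) * 2 ≤
      Real.exp (-(2 * lam * (M * 3720 / ν))) * (δ / 8) * lam * (200000 / δ) * (7 / 16) := by
  have hπ := Real.pi_gt_three
  have hπ4 := Real.pi_lt_four
  have ha0 : 0 ≤ a := le_trans (abs_nonneg _) hθ
  have hnν : 0 < n * ν := mul_pos hn hν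
  have hF0 : 0 < F := by linarith
  obtain ⟨G, hG⟩ : ∃ G : ℝ, (θ / (8 * π ^ 2 * F * bm * n * ν)) ^ 2 = G := ⟨_, rfl⟩
  rw [hG]
  have hG0 : 0 ≤ G := by rw [← hG]; positivity
  have hD : 72 * F * (n * ν) ≤ 8 * π ^ 2 * F * bm * n * ν := by
    have h1 : (9 : ℝ) ≤ π ^ 2 := by nlinarith only [hπ]
    have h2 : 9 * F ≤ π ^ 2 * F * bm := by
      have := mul_le_mul h1 hbm1 zero_le_one (by positivity)
      nlinarith only [this, hF0]
    nlinarith only [h2, hnν]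
  have hGa : G * (5184 * (F ^ 2 * (n ^ 2 * ν ^ 2))) ≤ a ^ 2 := by
    have hθ2 : θ ^ 2 ≤ a ^ 2 := by
      rw [← sq_abs]; exact pow_le_pow_left₀ (abs_nonneg _) hθ 2
    have hGD : G * (8 * π ^ 2 * F * bm * n * ν) ^ 2 = θ ^ 2 := by
      have hDpos : 0 < 8 * π ^ 2 * F * bm * n * ν := lt_of_lt_of_le (by positivity) hD
      rw [← hG, div_pow]; field_simp
    have hD2 : (72 * F * (n * ν)) ^ 2 ≤ (8 * π ^ 2 * F * bm * n * ν) ^ 2 :=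
      pow_le_pow_left₀ (by positivity) hD 2
    have := mul_le_mul_of_nonneg_left hD2 hG0
    nlinarith only [this, hGD, hθ2]
  -- the free decay factor
  have hE : 98 / 100 ≤ Real.exp (-(2 * lam * (M * 3720 / ν))) := by
    have := Real.add_one_le_exp (-(2 * lam * (M * 3720 / ν)))
    nlinarith only [this, hx, hlam0]
  -- right-hand side in closed form
  have e : Real.exp (-(2 * lam * (M * 3720 / ν))) * (δ / 8) * lam * (200000 / δ) * (7 / 16) =
      21875 / 2 * (lam * Real.exp (-(2 * lam * (M * 3720 / ν)))) := by
    field_simp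
    ring
  rw [e]
  have hr : 98 / 100 * (a ^ 2 / (10000 * (n ^ 2 * ν))) ≤ lam * Real.exp (-(2 * lam * (M * 3720 / ν))) := by
    have := mul_le_mul hlamlo hE (by norm_num) hlam0
    linarith only [this]
  -- left-hand side: `G·F·ν ≤ a²/(5184 F n² ν)`
  have hπ16 : π ^ 2 ≤ 16 := by nlinarith only [hπ4, hπ]
  have hΞ2 : Ξ ^ 2 ≤ 121 / 100 := by nlinarith only [hΞ0, hΞ]
  have hL : 16 * Ξ ^ 2 * G * (4 * π ^ 2 * F * ν) * 2 ≤ 2500 * (G * F * ν) := by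
    have hGFν : 0 ≤ G * F * ν := by positivity
    have h1 := mul_le_mul hΞ2 hπ16 (by positivity) (by norm_num)
    nlinarith only [h1, hGFν, hΞ2, hπ16, sq_nonneg Ξ, hΞ0]
  have hGFν : G * F * ν * (5184 * F * (n ^ 2 * ν)) ≤ a ^ 2 := by nlinarith only [hGa]
  have hF' : G * F * ν * (5184 * (n ^ 2 * ν)) ≤ a ^ 2 := by
    have h0 : 0 ≤ G * F * ν := by positivity
    have h1 : 5184 * (n ^ 2 * ν) ≤ 5184 * F * (n ^ 2 * ν) := by
      have : 0 ≤ 5184 * (F - 1) * (n ^ 2 * ν) := by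
        have := sub_nonneg.2 hF1; positivity
      nlinarith only [this]
    exact (mul_le_mul_of_nonneg_left h1 h0).trans hGFν
  have hQ' : 0 < 10000 * (n ^ 2 * ν) := by positivity
  have hkey : 2500 * (G * F * ν) ≤ 21875 / 2 * (98 / 100 * (a ^ 2 / (10000 * (n ^ 2 * ν)))) := by
    rw [show 21875 / 2 * (98 / 100 * (a ^ 2 / (10000 * (n ^ 2 * ν)))) =
        (21875 / 2 * (98 / 100) * a ^ 2) / (10000 * (n ^ 2 * ν)) by ring, le_div_iff₀ hQ']
    nlinarith only [hF']
  have hr' := mul_le_mul_of_nonneg_left hr (by norm_num : (0:ℝ) ≤ 21875 / 2)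
  linarith only [hL, hkey, hr']

/-- `hβ'` at the cell, per slot, with the global factor `Ξ = e^{4ΣY} ≤ 11/10` abstracted, looser `Ξ ≤ 6/5`: `16Ξ²g_j²Λ′_j·2 ≤ e^{−2λP′}ελβΔ`
(`ε = δ/8`, `β = 2·10⁵/δ`, `Δ = 7/16`). -/
theorem near_hβ' {θ a F bm M ν n lam δ Ξ : ℝ} (hθ : |θ| ≤ a) (hF1 : 1 ≤ F) (hbm1 : 1 ≤ bm)
    (hν : 0 < ν) (hn : 0 < n) (hδ : 0 < δ) (hlam0 : 0 ≤ lam) (hx : lam * (M * 3720 / ν) ≤ 1 / 100)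
    (hlamlo : a ^ 2 / (10000 * (n ^ 2 * ν)) ≤ lam) (hΞ0 : 0 ≤ Ξ) (hΞ : Ξ ≤ 6 / 5) :
    16 * Ξ ^ 2 * (θ / (8 * π ^ 2 * F * bm * n * ν)) ^ 2 * (4 * π ^ 2 * F * ν) * 2 ≤
      Real.exp (-(2 * lam * (M * 3720 / ν))) * (δ / 8) * lam * (200000 / δ) * (7 / 16) := by
  have hπ := Real.pi_gt_three
  have hπ4 := Real.pi_lt_four
  have ha0 : 0 ≤ a := le_trans (abs_nonneg _) hθ
  have hnν : 0 < n * ν := mul_pos hn hν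
  have hF0 : 0 < F := by linarith
  obtain ⟨G, hG⟩ : ∃ G : ℝ, (θ / (8 * π ^ 2 * F * bm * n * ν)) ^ 2 = G := ⟨_, rfl⟩
  rw [hG]
  have hG0 : 0 ≤ G := by rw [← hG]; positivity
  have hD : 72 * F * (n * ν) ≤ 8 * π ^ 2 * F * bm * n * ν := by
    have h1 : (9 : ℝ) ≤ π ^ 2 := by nlinarith only [hπ]
    have h2 : 9 * F ≤ π ^ 2 * F * bm := by
      have := mul_le_mul h1 hbm1 zero_le_one (by positivity)
      nlinarith only [this, hF0]
    nlinarith only [h2, hnν]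
  have hGa : G * (5184 * (F ^ 2 * (n ^ 2 * ν ^ 2))) ≤ a ^ 2 := by
    have hθ2 : θ ^ 2 ≤ a ^ 2 := by
      rw [← sq_abs]; exact pow_le_pow_left₀ (abs_nonneg _) hθ 2
    have hGD : G * (8 * π ^ 2 * F * bm * n * ν) ^ 2 = θ ^ 2 := by
      have hDpos : 0 < 8 * π ^ 2 * F * bm * n * ν := lt_of_lt_of_le (by positivity) hD
      rw [← hG, div_pow]; field_simp
    have hD2 : (72 * F * (n * ν)) ^ 2 ≤ (8 * π ^ 2 * F * bm * n * ν) ^ 2 :=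
      pow_le_pow_left₀ (by positivity) hD 2
    have := mul_le_mul_of_nonneg_left hD2 hG0
    nlinarith only [this, hGD, hθ2]
  -- the free decay factor
  have hE : 98 / 100 ≤ Real.exp (-(2 * lam * (M * 3720 / ν))) := by
    have := Real.add_one_le_exp (-(2 * lam * (M * 3720 / ν)))
    nlinarith only [this, hx, hlam0]
  -- right-hand side in closed form
  have e : Real.exp (-(2 * lam * (M * 3720 / ν))) * (δ / 8) * lam * (200000 / δ) * (7 / 16) =
      21875 / 2 * (lam * Real.exp (-(2 * lam * (M * 3720 / ν)))) := by
    field_simp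
    ring
  rw [e]
  have hr : 98 / 100 * (a ^ 2 / (10000 * (n ^ 2 * ν))) ≤ lam * Real.exp (-(2 * lam * (M * 3720 / ν))) := by
    have := mul_le_mul hlamlo hE (by norm_num) hlam0
    linarith only [this]
  -- left-hand side: `G·F·ν ≤ a²/(5184 F n² ν)`
  have hπ16 : π ^ 2 ≤ 16 := by nlinarith only [hπ4, hπ]
  have hΞ2 : Ξ ^ 2 ≤ 144 / 100 := by nlinarith only [hΞ0, hΞ]
  have hL : 16 * Ξ ^ 2 * G * (4 * π ^ 2 * F * ν) * 2 ≤ 3000 * (G * F * ν) := by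
    have hGFν : 0 ≤ G * F * ν := by positivity
    have h1 := mul_le_mul hΞ2 hπ16 (by positivity) (by norm_num)
    nlinarith only [h1, hGFν, hΞ2, hπ16, sq_nonneg Ξ, hΞ0]
  have hGFν : G * F * ν * (5184 * F * (n ^ 2 * ν)) ≤ a ^ 2 := by nlinarith only [hGa]
  have hF' : G * F * ν * (5184 * (n ^ 2 * ν)) ≤ a ^ 2 := by
    have h0 : 0 ≤ G * F * ν := by positivity
    have h1 : 5184 * (n ^ 2 * ν) ≤ 5184 * F * (n ^ 2 * ν) := by
      have : 0 ≤ 5184 * (F - 1) * (n ^ 2 * ν) := by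
        have := sub_nonneg.2 hF1; positivity
      nlinarith only [this]
    exact (mul_le_mul_of_nonneg_left h1 h0).trans hGFν
  have hQ' : 0 < 10000 * (n ^ 2 * ν) := by positivity
  have hkey : 3000 * (G * F * ν) ≤ 21875 / 2 * (98 / 100 * (a ^ 2 / (10000 * (n ^ 2 * ν)))) := by
    rw [show 21875 / 2 * (98 / 100 * (a ^ 2 / (10000 * (n ^ 2 * ν)))) =
        (21875 / 2 * (98 / 100) * a ^ 2) / (10000 * (n ^ 2 * ν)) by ring, le_div_iff₀ hQ']
    nlinarith only [hF']
  have hr' := mul_le_mul_of_nonneg_left hr (by norm_num : (0:ℝ) ≤ 21875 / 2)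
  linarith only [hL, hkey, hr']

end Summit.AnomalousDissipation.AnomalousDissipation.Theorems.SolenoidalFractalHomogenisation.RealisedQuasiStaticCellLaw

end
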